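import Summits.HodgeConjecture.CorCM.MumfordTateRankCMSurfaceTimesTypeIV
import Summits.HodgeConjecture.CorCM.MumfordTateRankCMSurfaceTimesCMThreefold
import Summits.HodgeConjecture.CorCM.MumfordTateRankTimesRealMultiplicationCells
import Summits.HodgeConjecture.CorCM.MumfordTateRankTimesLowGeneric
import Summits.HodgeConjecture.CorCM.MumfordTateRankTimesNonCMCurve
import Summits.HodgeConjecture.CorCM.MumfordTateRankSimpleSurfacesSharp
import HarnessLib

/-!
# The dimension-`5` partition `{2, 3}`: `dim MT(H¹(S × T)) + 1 = dim MT(H¹S) + dim MT(H¹T)` for EVERY simple abelian surface `S` and EVERY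
# simple abelian threefold `T` — `Hg(S × T) = Hg(S) × Hg(T)` always — and the table `t(S × T) ∈ {6, 7, 10, 12, 13, 14, 16, 20, 24, 25, 28, 32}`

COR-CM (cell `pub-hodgecm2`, seat `b27` gen 49, count-neutral Mumford–Tate-rank ladder; theorems only, no definition, no named fact;
UNCONDITIONAL — nothing here uses or asserts HC_CM).  Notation `t(X) = dim MT(H¹X)`.

Moonen–Zarhin, Math. Ann. 315 (1999), Thm. (0.2) and §5: for a complex abelian FIVEFOLD `X ∼ Y₁ × Y₂` with `Y₁` a simple surface and
`Y₂` a simple threefold, `Hg(X) = Hg(Y₁) × Hg(Y₂)` in all cases ((5.2) both of type IV = CM surface × type-IV threefold: Thm. (3.2)(2)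
when `Y₂` is of CM type — the pair is never one of (e), (f), (g) —, Lemma (3.6) otherwise ((5.6): «`U_{F₁}` is not isogenous to a subtorus
of `U_k`»); (5.3) `Y₁` not of type IV: Lemma (3.4)).  On the ladder every cell is now a theorem of the tree:
* `S` NOT of CM type (`End⁰S = ℚ`, real quadratic, indefinite quaternion — `t(S) = 11, 7, 4`): gen 47's engine
  `mtRank_hodge_one_add_one_eq_add_of_isIsogenous_prod_simpleSurface_of_not_isOfCMType` (Lemma (3.4) for `hodgeLie`);
* `S` of CM type (`t(S) = 3`) and `End⁰T = ℚ` (`t(T) = 22`): `mtRank_hodge_one_eq_add_of_isIsogenous_prod_threefold_endRankOne`; `End⁰T` a cubic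
  field (`t(T) = 10`): `mtRank_hodge_one_eq_add_nine_of_isIsogenous_prod_threefold_of_finrank_endAlgebra_eq_three`; `End⁰T` imaginary
  quadratic (`t(T) = 10`): `mtRank_hodge_one_eq_twelve_of_isIsogenous_cmSurface_prod_isSimple_threefold` (gen 49, Lemma (3.6) + twisted
  rigidity); `T` of CM type (`t(T) = 4`): `mtRank_hodge_one_eq_six_of_isIsogenous_cmSurface_prod_cmThreefold` (gen 49, after seat b16).

* **`mtRank_hodge_one_add_one_eq_add_of_isIsogenous_simpleSurface_prod_simpleThreefold`** — `t(X) + 1 = t(S) + t(T)` for every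
  `X ∼ S × T`, `S` a simple abelian surface, `T` a simple abelian threefold.
* **`mtRank_hodge_one_mem_of_isIsogenous_simpleSurface_prod_simpleThreefold`** — `t(X) ∈ {6, 7, 10, 12, 13, 14, 16, 20, 24, 25, 28, 32}`
  (`(t(S), t(T)) ∈ {3, 4, 7, 11} × {4, 10, 22}`).

## References
* [MoonenZarhin1999LowDim] B. Moonen, Yu. G. Zarhin, *Hodge classes on abelian varieties of low dimension*, Math. Ann. 315 (1999), Thm. (0.2),
  §2 (2.2)–(2.3), §3 Thm. (3.2)(2), Lemmas (3.4), (3.6), §5 (5.2)–(5.3), (5.6) [corpus: paper:arxiv-math_9901113 pp. 1–2, 5–7, 9–10].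
  [cite: MoonenZarhin1999LowDim, Thm. (0.2) (4) and §5 (5.2)–(5.3)]
* [MumfordAV1970] D. Mumford, *Abelian Varieties* (1970), §19 Thm. 1, Cor. 1–2. [cite: MumfordAV1970, §19 Cor. 2 of Thm. 1]
-/

noncomputable section

open CategoryTheory CategoryTheory.Limits Module

namespace Summit.HodgeConjecture.CorCM

open Literature.AlgebraicGeometry.Motives
open Literature.AlgebraicGeometry.Motives.AbelianVariety
open Literature.AlgebraicGeometry.Motives.HodgeStructure
open Literature.AlgebraicGeometry.HodgeTheory
open Literature.AlgebraicGeometry.Milne1999 (IsOfCMType)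

variable [HodgeTensorFacts.{0, 0}] {X : AbelianVariety ℂ} {n : ℕ}

/-- **`t(X) + 1 = t(S) + t(T)` for every `X ∼ S × T` with `S` a simple abelian surface and `T` a simple abelian threefold** —
`Hg(S × T) = Hg(S) × Hg(T)` in every one of the `4 × 4` endomorphism-type cells (Moonen–Zarhin Thm. (0.2): a fivefold with simple factors of
dimensions `2` and `3` is never in the exceptional cases (e), (f), (g)).  Assembled from the rows listed in the module docstring.
[cite: MoonenZarhin1999LowDim, Thm. (0.2) (4) and §5 (5.2)–(5.3)] [cite: MumfordAV1970, §19 Cor. 2 of Thm. 1] -/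
theorem mtRank_hodge_one_add_one_eq_add_of_isIsogenous_simpleSurface_prod_simpleThreefold (hX : IsSmoothProjective n X.X)
    {S T : AbelianVariety ℂ} {k l : ℕ} (hS : IsSmoothProjective k S.X) (hT : IsSmoothProjective l T.X) (hSs : S.IsSimple) (hS2 : S.dim = 2)
    (hTs : T.IsSimple) (hT3 : T.dim = 3) (hXP : IsIsogenous X (S.prod T)) :
    haveI := BettiUniverse.finite hX 1
    haveI := BettiUniverse.finite hS 1
    haveI := BettiUniverse.finite hT 1
    (BettiUniverse.hodge exists_isReal_hodgeModel_holds hX 1).mtRank + 1 =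
      (BettiUniverse.hodge exists_isReal_hodgeModel_holds hS 1).mtRank + (BettiUniverse.hodge exists_isReal_hodgeModel_holds hT 1).mtRank := by
  classical
  have hkS : S.dim = k := schemeDim_eq_holds hS
  have hlT : T.dim = l := schemeDim_eq_holds hT
  subst hkS hlT
  haveI := BettiUniverse.finite hX 1
  haveI := BettiUniverse.finite hS 1
  haveI := BettiUniverse.finite hT 1
  have hS0 : 0 < S.dim := by omega
  have hT0 : 0 < T.dim := by omega
  have hST : ∀ u : S ⟶ T, u = 0 := fun u => hom_eq_zero_of_isSimple_of_dim_ne hSs hTs (by omega) u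
  have hTS : ∀ u : T ⟶ S, u = 0 := fun u => hom_eq_zero_of_isSimple_of_dim_ne hTs hSs (by omega) u
  have hXP' : IsIsogenous X (T.prod S) := hXP.trans (isIsogenous_prod_comm S T)
  have hiff := isOfCMType_iff_mtRank_hodge_one_eq_three_of_isSimple_surface hS hSs hS2
  by_cases hScm : IsOfCMType S
  · -- `S` of CM type: `t(S) = 3`
    have h3 := hiff.1 hScm
    rcases mtRank_hodge_one_of_isSimple_threefold hT hTs hT3 with ⟨h1, h22⟩ | ⟨h2, h10⟩ | ⟨h3', h10⟩ | ⟨-, hTcm, h4⟩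
    · have h := mtRank_hodge_one_eq_add_of_isIsogenous_prod_threefold_endRankOne hX hS hS0 hT3 h1 hST hXP
      omega
    · have h := mtRank_hodge_one_eq_twelve_of_isIsogenous_cmSurface_prod_isSimple_threefold hX hSs hS2 hScm hTs hT3 h2 hXP
      omega
    · have h := mtRank_hodge_one_eq_add_nine_of_isIsogenous_prod_threefold_of_finrank_endAlgebra_eq_three hX hS hS0 hTs hT3 h3' hST hXP
      omega
    · have h := mtRank_hodge_one_eq_six_of_isIsogenous_cmSurface_prod_cmThreefold hX hSs hS2 hScm hTs hT3 hTcm hXP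
      omega
  · -- `S` not of CM type: Lemma (3.4) for `hodgeLie`
    have h := mtRank_hodge_one_add_one_eq_add_of_isIsogenous_prod_simpleSurface_of_not_isOfCMType hX hT hS hT0 hSs hS2 hScm hTS hXP'
    omega

/-- **The Mumford–Tate rank of a product of a simple abelian surface and a simple abelian threefold is one of
`6, 7, 10, 12, 13, 14, 16, 20, 24, 25, 28, 32`** (`t(S) ∈ {3, 4, 7, 11}`, `t(T) ∈ {4, 10, 22}`, `t(S × T) = t(S) + t(T) − 1`; all twelve values
occur: `(3,4) ↦ 6`, `(4,4) ↦ 7`, `(7,4) ↦ 10`, `(3,10) ↦ 12`, `(4,10) ↦ 13`, `(11,4) ↦ 14`, `(7,10) ↦ 16`, `(11,10) ↦ 20`, `(3,22) ↦ 24`,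
`(4,22) ↦ 25`, `(7,22) ↦ 28`, `(11,22) ↦ 32`). [cite: MoonenZarhin1999LowDim, Thm. (0.2) (4), §2 (2.2)–(2.3) and §5] -/
theorem mtRank_hodge_one_mem_of_isIsogenous_simpleSurface_prod_simpleThreefold (hX : IsSmoothProjective n X.X) {S T : AbelianVariety ℂ}
    (hSs : S.IsSimple) (hS2 : S.dim = 2) (hTs : T.IsSimple) (hT3 : T.dim = 3) (hXP : IsIsogenous X (S.prod T)) :
    haveI := BettiUniverse.finite hX 1
    (BettiUniverse.hodge exists_isReal_hodgeModel_holds hX 1).mtRank ∈ ({6, 7, 10, 12, 13, 14, 16, 20, 24, 25, 28, 32} : Set ℕ) := by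
  have hS : IsSmoothProjective S.dim S.X := AbelianVariety.isSmoothProjective_holds
  have hT : IsSmoothProjective T.dim T.X := AbelianVariety.isSmoothProjective_holds
  haveI := BettiUniverse.finite hX 1
  haveI := BettiUniverse.finite hS 1
  haveI := BettiUniverse.finite hT 1
  have h := mtRank_hodge_one_add_one_eq_add_of_isIsogenous_simpleSurface_prod_simpleThreefold hX hS hT hSs hS2 hTs hT3 hXP
  simp only [Set.mem_insert_iff, Set.mem_singleton_iff]
  rcases mtRank_hodge_one_mem_of_isSimple_surface hS hSs hS2 with hs | hs | hs | hs <;>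
    rcases mtRank_hodge_one_mem_of_isSimple_threefold hT hTs hT3 with ht | ht | ht <;> omega

/-- **No product of a simple abelian surface and a simple abelian threefold has Mumford–Tate rank outside
`{6, 7, 10, 12, 13, 14, 16, 20, 24, 25, 28, 32}`** — e.g. `t ≠ 11`, `t ≠ 22`, and `t < 6` or `32 < t` never occur.
[cite: MoonenZarhin1999LowDim, Thm. (0.2) (4) and §5] -/
theorem mtRank_hodge_one_le_and_le_of_isIsogenous_simpleSurface_prod_simpleThreefold (hX : IsSmoothProjective n X.X) {S T : AbelianVariety ℂ}
    (hSs : S.IsSimple) (hS2 : S.dim = 2) (hTs : T.IsSimple) (hT3 : T.dim = 3) (hXP : IsIsogenous X (S.prod T)) :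
    haveI := BettiUniverse.finite hX 1
    6 ≤ (BettiUniverse.hodge exists_isReal_hodgeModel_holds hX 1).mtRank ∧ (BettiUniverse.hodge exists_isReal_hodgeModel_holds hX 1).mtRank ≤ 32 ∧
      (BettiUniverse.hodge exists_isReal_hodgeModel_holds hX 1).mtRank ≠ 11 ∧ (BettiUniverse.hodge exists_isReal_hodgeModel_holds hX 1).mtRank ≠ 22 := by
  have h := mtRank_hodge_one_mem_of_isIsogenous_simpleSurface_prod_simpleThreefold hX hSs hS2 hTs hT3 hXP
  simp only [Set.mem_insert_iff, Set.mem_singleton_iff] at h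
  omega

end Summit.HodgeConjecture.CorCM

end
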